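import Summits.QuantumFields.YangMills.Theorems.BalabanUVNodesN11GaussianCertificateRows
import Summits.QuantumFields.YangMills.Theorems.BalabanUVNodesN11SpaceTruncationAtSepIndices

/-!
# DAG node N11 — THE GAUSSIAN CERTIFICATE CLASS MEETS dag-n11-d's DOOR (d4) (SPACE TRUNCATION): at a Gaussian certificate the no-expansion 𝐓-step on the background-reading
# line asks ONLY the 𝐁-terms' joint measurability (def-T's located residue), the residual's reading-region law `RegOn`, def-R's `BgProvisoΛ` over the reading
# support, the run's window and the signs — every residual row ((P), (V), `quad_k(∅)=0`, locality, measurability) and every (K0b) A-fibre domination row DISCHARGED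

HEADER — WORK-UNIT METADATA.  Cell `pub-ymgap`, YM-PLAN Track A (D-0062 ∕ D-0149 width seats), seat `pub-ymgap-dag-n11-w1` (g0; WIDTH SEAT 1 of 4 on NODE n11 [B14]),
route `BalabanUVNodes` rev 25, item K1⁷ `StabilityBAtRecordR13SepCoPH` = stmt-QuantumFields-20542 (helper, `--kind proof --supports 20542 --as helper`, count-neutral).
[III] = [Balaban1988Convergent].  ONE composition: dag-n11-d g11's ★★★ `…N11SpaceTruncation.exists_local_witness_clause_succ_of_sLaw₁₃CoPH_of_bgRead` (door (d4): five of def-T's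
six term rows discharged by the space truncation of the §2 witness, replaced by rows on PRIMITIVES OF RECORD) ∘ this seat's `…N11GaussianCertificateRows` (every residual row of
the class) ∘ dag-n11-w4's `afibre_rows_adm_of_coercive` (the (K0b) rows from unit coercivity).

WHAT THIS FILE PROVES (0 `sorry`, 0 `def`; nothing of Bałaban asserted).  ★★★ `exists_local_witness_clause_succ_of_gaussCert_of_bgRead`: for `θ` of the Gaussian class
(certificate `ζ0`, A-fibre Gaussian `quad`) with core provisos, admissibility, the §2 signs, `k < K`, `1 ≤ M`, the run inside the window at the levels below `k`, a
reading selector `Γr` with the `RegOn` law of the residual and def-R's `BgProvisoΛ` over the reading support: from `SLaw₁₃CoPH θ p k` one `k`-local law-abiding witness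
`(t, E_k)` such that at EVERY no-expansion history the 𝐓-image clause holds as soon as the 𝐁-terms of `t (init s′)` are JOINTLY measurable in `(U, A)` at the embedded
background — dag-n11-d's LOCATED residue (r11's `LFHypAnalytic.analyticB` is per fixed `a`), AND NOTHING ELSE of the no-expansion side.  ★★★★
`exists_local_witness_clause_succ_of_gaussCert_of_borelB_of_bgRead`: the same over dag-n11-d's WITNESS-FIRST face `…SpaceTruncationBorelB…` — for a NAMED §2 witness whose
𝐁-terms are Borel along the embedding (`hBt`), the clause at EVERY no-expansion history from the reading-line primitives ONLY (no term row, no (K0b) row, no pin).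

HONEST FRAMING.  Helper lane of K1⁷; kernel composition; `RegOn`, `BgProvisoΛ`, the window and the 𝐁-measurability row stay DISPLAYED (dag-n11-d's
`…_of_sep_of_junction` reads `BgProvisoΛ` off `Provisos₁₃SepCoPH` given partition compatibility and the junction); a Gaussian certificate carries a RANGE value of `quad`
(no-expansion analysis only), NOT node00-def-K0b's value of record.  N11 NOT discharged; K1⁷ NOT closed; counts unmoved (typed 28∕28 · discharged 5∕27).  R4 closes only
the conditional finite-𝕋⁴ rung `BalabanLadder.UV` of one programme at fixed `ε = L^{−K}` — NOT ℝ⁴, NOT OS, NOT a mass gap, NOT Clay.  No `sorry`, `axiom`, `instance`, `notation`.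
Sources (SHAPE only): [III] Theorem p.245, Thm 1 p.262, (2.10) p.256, (2.18) p.257, (2.21)–(2.23) p.258, (2.27)–(2.28) p.259, (3.16)–(3.25) pp.268–270.
-/

noncomputable section

open MeasureTheory
open scoped BigOperators ENNReal NNReal Matrix.Norms.L2Operator

namespace Summit.QuantumFields.YangMills.Theorems.BalabanUVNodesN11GaussianCertificateBgRead

open Literature.MathematicalPhysics.QuantumFieldTheory.Balaban1983to89 T4Continuum T4NestedCovariance Node00 Node00.Tk DagBinding
open B15DeterminingSets B8Eq17ClassAkV1 Step
open B10Eq42TorusConstraint (bondsIn)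
open BalabanUVNodesN11HistoryPinnedResidualDefs (ZhPinOfRecord₁₃)
open BalabanUVNodesN11FluctTruncationDefs (IsFluctLocal)
open BalabanUVNodesN11AFibreDominationOfCoercive (afibre_rows_adm_of_coercive)
open BalabanUVNodesN11SpaceTruncation (exists_local_witness_clause_succ_of_sLaw₁₃CoPH_of_bgRead)
open BalabanUVNodesN11SpaceTruncationBorelB (exists_local_witness_clause_succ_of_hasSect2FormAtZS_of_borelB_of_bgRead)
open BalabanUVNodesN11GaussianCertificateRows

variable {F : T4Family} {N : ℕ} [NeZero N]
variable (θ : Stage13HParams F N) (p : B12.RunParams)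

/-- **★★★ THE NO-EXPANSION 𝐓-STEP AT A GAUSSIAN CERTIFICATE ON THE BACKGROUND-READING LINE — the 𝐁-terms' joint measurability ONLY** (plus the displayed primitives:
`RegOn`, `BgProvisoΛ`, the window, the signs): dag-n11-d's door (d4) ★★★ `…_of_bgRead` with its six residual rows and its (K0b) rows DISCHARGED for the Gaussian class
(`…GaussianCertificateRows` §1; the (K0b) rows through dag-n11-w4's `afibre_rows_adm_of_coercive` and unit coercivity).
[cite: Balaban1988Convergent, Theorem p.245, Thm 1 p.262, (3.24)–(3.25) p.270, (2.10) p.256, (2.21)–(2.23) p.258, (2.27)–(2.28) p.259] -/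
theorem exists_local_witness_clause_succ_of_gaussCert_of_bgRead
    (hζ : ∀ (p : B12.RunParams) (n : ℕ) (Ω Λ : ℕ → Set (Site (F.P p.K) 0)), (θ.Zh p n Ω Λ).ζ0 = (ZhPinOfRecord₁₃ θ.toStage13Params p Ω Λ).ζ0)
    (hq : ∀ (p : B12.RunParams) (n : ℕ) (Ω Λ : ℕ → Set (Site (F.P p.K) 0)) (j : ℕ) (Λ' : Set (Site (F.P p.K) 0)) (ω : MultiCfg (F.P p.K) (SU N) (FluctV N)),
      (θ.Zh p n Ω Λ).quad j Λ' ω = ∑ b ∈ (Set.toFinite (bondsIn j (Λ'ᶜ ∩ Ω (j + 1)))).toFinset, ‖(ω j).2 b‖ ^ 2)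
    (h : θ.Provisos₁₃CoPH F N) (hθ : θ.Admissible F N) (hpos : θ.s2.Pos)
    {k : ℕ} (hk : k < p.K) (hM : 1 ≤ θ.τ9.M) (hw : Step.InInterval θ.γ k (gOfRecord₁₃ F N θ.toStage13Params p))
    (cR : ℝ) (Γr : SeqOfRecord F θ.ν θ.τ9.M (gOfRecord₁₃ F N θ.toStage13Params p) p.K k → ℕ → Set (Site (F.P p.K) 0) → Set (Site (F.P p.K) 0))
    (hreg : ∀ s₀, (θ.zhAt p s₀).RegOn F N (FluctV N) θ.ν cR p (gOfRecord₁₃ F N θ.toStage13Params p) (Γr s₀))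
    (hbg : BgProvisoΛ F N p.K (settingOfRecord₁₃ F N θ.toStage13Params p) (θ.Rz p.K) θ.τ9.M k
      (fun s₀ => {Wc | chiSeqOfRecord F N θ.ν θ.τ9.M (gOfRecord₁₃ F N θ.toStage13Params p) p.K k s₀ (Wc k) ≠ 0 ∧
        ∀ j, j < k → PlaqSmallOn (plaqsOf (pts j (Γr s₀ j (s₀.Ω (j + 1))ᶜ))) (cR * epsOfRecord θ.ν (gOfRecord₁₃ F N θ.toStage13Params p) j) (Wc j)})
      (UbgOfRecord₁₃CoP F N θ.toStage13Params p k))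
    (hS : SLaw₁₃CoPH F N θ p k) :
    ∃ (t : SeqOfRecord F θ.ν θ.τ9.M (gOfRecord₁₃ F N θ.toStage13Params p) p.K k → Sect2.TermValues (F.P p.K) (MatA N) (FluctV N) θ.τ9.M)
      (Ek : SeqOfRecord F θ.ν θ.τ9.M (gOfRecord₁₃ F N θ.toStage13Params p) p.K k → ℝ),
      HasSect2FormAtZS F N (FluctV N) p.K (settingOfRecord₁₃ F N θ.toStage13Params p) k (θ.rzAt p) (WtOfRecord₁₃H F N θ p)
          (UbgOfRecord₁₃CoP F N θ.toStage13Params p k)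
          (fun s₀ t₀ => Sect2.LawsRT (sect2TowerOfRecord F N (FluctV N) p.K (settingOfRecord₁₃ F N θ.toStage13Params p) (θ.rzAt p s₀) s₀ t₀)
            (settingOfRecord₁₃ F N θ.toStage13Params p).lf k)
          (slotsOfRecord F N θ.ν θ.τ9 (EOfRecord₁₃ F N θ.toStage13Params) (wOfRecord₉ F N θ.toStage9Params) θ.ppSel p
            (gOfRecord₁₃ F N θ.toStage13Params p) k) t Ek ∧
      (∀ s₀, IsFluctLocal k (t s₀)) ∧
      ∀ (s : SeqOfRecord F θ.ν θ.τ9.M (gOfRecord₁₃ F N θ.toStage13Params p) p.K (k + 1)), s.Ω (k + 1) = ∅ →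
        -- def-T: the 𝐁-terms of the witness at the parent history, READ AT THE EMBEDDED BACKGROUND, are JOINTLY measurable in `(U, A)` (LOCATED residue)
        (∀ (S' : ℕ → Set (Site (F.P p.K) 0)) (j : ℕ) (X : (Sect2.domSys (F.P p.K) θ.τ9.M j).Dom),
          Measurable (fun q : GaugeField (F.P p.K) 0 (SU N) × MSFluct (F.P p.K) (FluctV N) =>
            ((t s.init).B j X (Sect2.ofBackgroundC (settingOfRecord₁₃ F N θ.toStage13Params p).ι q.1) (S', q.2)).re)) →
        (slotsTOfRecord F N θ.ν θ.τ9 (EOfRecord₁₃ F N θ.toStage13Params) (wOfRecord₉ F N θ.toStage9Params) θ.ppSel p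
            (gOfRecord₁₃ F N θ.toStage13Params p) (k + 1) s = 0 ∨
          ∀ᵐ V' ∂fieldMeasure (F.P p.K) (k + 1) (SU N),
            chiSeqOfRecord F N θ.ν θ.τ9.M (gOfRecord₁₃ F N θ.toStage13Params p) p.K (k + 1) s V' ≠ 0 →
              slotsTOfRecord F N θ.ν θ.τ9 (EOfRecord₁₃ F N θ.toStage13Params) (wOfRecord₉ F N θ.toStage9Params) θ.ppSel p
                  (gOfRecord₁₃ F N θ.toStage13Params p) (k + 1) s V' =
                sect2Slot F N (FluctV N) p.K (settingOfRecord₁₃ F N θ.toStage13Params p) (θ.rzAt p s) (WtOfRecord₁₃H F N θ p s) s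
                  (t s.init) (Ek s.init) (UbgOfRecord₁₃CoP F N θ.toStage13Params p (k + 1) s) V') := by
  obtain ⟨t, Ek, hform, hloc, H⟩ :=
    exists_local_witness_clause_succ_of_sLaw₁₃CoPH_of_bgRead θ p h (zhUnity_of_gaussCert θ hζ) hθ hpos hk hM hw cR Γr hreg hbg hS
  exact ⟨t, Ek, hform, hloc, fun s hΩ hB =>
    H s hΩ (prefix_agree_of_gaussCert θ p hζ hq s hΩ) (ζ0_pin_of_gaussCert θ p hζ hk s hΩ) (quad_empty_pairCfgAt_of_gaussCert θ p hq s)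
      (quad_local_of_gaussCert θ p hq s) (fun j Y => measurable_ζ0_of_gaussCert θ p hζ h s j Y) (fun j Λ' => measurable_quad_of_gaussCert θ p hq s j Λ')
      (afibre_rows_adm_of_coercive θ p s fun j => coercive_of_gaussCert θ p hq s j) hB⟩

/-- **★★★★ AT A GAUSSIAN CERTIFICATE, FOR A NAMED BOREL WITNESS, THE NO-EXPANSION 𝐓-IMAGE CLAUSE HOLDS AT EVERY NO-EXPANSION HISTORY — from the reading-line primitives
ONLY** (`RegOn` of the residual, def-R's `BgProvisoΛ` over the reading support, the run's window, the signs): dag-n11-d's witness-first door (d4) face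
`…SpaceTruncationBorelB.exists_local_witness_clause_succ_of_hasSect2FormAtZS_of_borelB_of_bgRead` (the named §2 witness `(t₀, E₀)` of `ρ_k`'s form with its 𝐁-terms Borel along the
embedding jointly in `(U, A)`: `hBt` — ALL six term rows gone) with its per-history residual rows and (K0b) rows DISCHARGED for the Gaussian class.  No term row, no (K0b)
row, no pin, no thin-region exception: what dag-n11-e's witness chain can ask of door (d3)+(d4) at a Gaussian certificate for a supplier with explicit Borel terms.
[cite: Balaban1988Convergent, Theorem p.245, Thm 1 p.262, (3.24)–(3.25) p.270, (2.10) p.256, (2.21)–(2.23) p.258, (2.27)–(2.28) p.259] -/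
theorem exists_local_witness_clause_succ_of_gaussCert_of_borelB_of_bgRead
    (hζ : ∀ (p : B12.RunParams) (n : ℕ) (Ω Λ : ℕ → Set (Site (F.P p.K) 0)), (θ.Zh p n Ω Λ).ζ0 = (ZhPinOfRecord₁₃ θ.toStage13Params p Ω Λ).ζ0)
    (hq : ∀ (p : B12.RunParams) (n : ℕ) (Ω Λ : ℕ → Set (Site (F.P p.K) 0)) (j : ℕ) (Λ' : Set (Site (F.P p.K) 0)) (ω : MultiCfg (F.P p.K) (SU N) (FluctV N)),
      (θ.Zh p n Ω Λ).quad j Λ' ω = ∑ b ∈ (Set.toFinite (bondsIn j (Λ'ᶜ ∩ Ω (j + 1)))).toFinset, ‖(ω j).2 b‖ ^ 2)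
    (h : θ.Provisos₁₃CoPH F N) (hθ : θ.Admissible F N)
    (hpos : θ.s2.Pos) {k : ℕ} (hk : k < p.K) (hM : 1 ≤ θ.τ9.M) (hw : Step.InInterval θ.γ k (gOfRecord₁₃ F N θ.toStage13Params p))
    (cR : ℝ) (Γr : SeqOfRecord F θ.ν θ.τ9.M (gOfRecord₁₃ F N θ.toStage13Params p) p.K k → ℕ → Set (Site (F.P p.K) 0) → Set (Site (F.P p.K) 0))
    (hreg : ∀ s₀, (θ.zhAt p s₀).RegOn F N (FluctV N) θ.ν cR p (gOfRecord₁₃ F N θ.toStage13Params p) (Γr s₀))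
    (hbg : BgProvisoΛ F N p.K (settingOfRecord₁₃ F N θ.toStage13Params p) (θ.Rz p.K) θ.τ9.M k
      (fun s₀ => {Wc | chiSeqOfRecord F N θ.ν θ.τ9.M (gOfRecord₁₃ F N θ.toStage13Params p) p.K k s₀ (Wc k) ≠ 0 ∧
        ∀ j, j < k → PlaqSmallOn (plaqsOf (pts j (Γr s₀ j (s₀.Ω (j + 1))ᶜ))) (cR * epsOfRecord θ.ν (gOfRecord₁₃ F N θ.toStage13Params p) j) (Wc j)})
      (UbgOfRecord₁₃CoP F N θ.toStage13Params p k))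
    (t₀ : SeqOfRecord F θ.ν θ.τ9.M (gOfRecord₁₃ F N θ.toStage13Params p) p.K k → Sect2.TermValues (F.P p.K) (MatA N) (FluctV N) θ.τ9.M)
    (E₀ : SeqOfRecord F θ.ν θ.τ9.M (gOfRecord₁₃ F N θ.toStage13Params p) p.K k → ℝ)
    (hform₀ : HasSect2FormAtZS F N (FluctV N) p.K (settingOfRecord₁₃ F N θ.toStage13Params p) k (θ.rzAt p) (WtOfRecord₁₃H F N θ p)
      (UbgOfRecord₁₃CoP F N θ.toStage13Params p k)
      (fun s₀ t' => Sect2.LawsRT (sect2TowerOfRecord F N (FluctV N) p.K (settingOfRecord₁₃ F N θ.toStage13Params p) (θ.rzAt p s₀) s₀ t')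
        (settingOfRecord₁₃ F N θ.toStage13Params p).lf k)
      (slotsOfRecord F N θ.ν θ.τ9 (EOfRecord₁₃ F N θ.toStage13Params) (wOfRecord₉ F N θ.toStage9Params) θ.ppSel p (gOfRecord₁₃ F N θ.toStage13Params p) k) t₀ E₀)
    (hBt : ∀ s₀ (S' : ℕ → Set (Site (F.P p.K) 0)) (j : ℕ) (X : (Sect2.domSys (F.P p.K) θ.τ9.M j).Dom),
      Measurable (fun q : GaugeField (F.P p.K) 0 (SU N) × MSFluct (F.P p.K) (FluctV N) =>
        (t₀ s₀).B j X (Sect2.ofBackgroundC (settingOfRecord₁₃ F N θ.toStage13Params p).ι q.1) (S', q.2))) :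
    ∃ (t : SeqOfRecord F θ.ν θ.τ9.M (gOfRecord₁₃ F N θ.toStage13Params p) p.K k → Sect2.TermValues (F.P p.K) (MatA N) (FluctV N) θ.τ9.M)
      (Ek : SeqOfRecord F θ.ν θ.τ9.M (gOfRecord₁₃ F N θ.toStage13Params p) p.K k → ℝ),
      HasSect2FormAtZS F N (FluctV N) p.K (settingOfRecord₁₃ F N θ.toStage13Params p) k (θ.rzAt p) (WtOfRecord₁₃H F N θ p)
          (UbgOfRecord₁₃CoP F N θ.toStage13Params p k)
          (fun s₀ t₀ => Sect2.LawsRT (sect2TowerOfRecord F N (FluctV N) p.K (settingOfRecord₁₃ F N θ.toStage13Params p) (θ.rzAt p s₀) s₀ t₀)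
            (settingOfRecord₁₃ F N θ.toStage13Params p).lf k)
          (slotsOfRecord F N θ.ν θ.τ9 (EOfRecord₁₃ F N θ.toStage13Params) (wOfRecord₉ F N θ.toStage9Params) θ.ppSel p
            (gOfRecord₁₃ F N θ.toStage13Params p) k) t Ek ∧
      (∀ s₀, IsFluctLocal k (t s₀)) ∧
      ∀ (s : SeqOfRecord F θ.ν θ.τ9.M (gOfRecord₁₃ F N θ.toStage13Params p) p.K (k + 1)), s.Ω (k + 1) = ∅ →
        (slotsTOfRecord F N θ.ν θ.τ9 (EOfRecord₁₃ F N θ.toStage13Params) (wOfRecord₉ F N θ.toStage9Params) θ.ppSel p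
            (gOfRecord₁₃ F N θ.toStage13Params p) (k + 1) s = 0 ∨
          ∀ᵐ V' ∂fieldMeasure (F.P p.K) (k + 1) (SU N),
            chiSeqOfRecord F N θ.ν θ.τ9.M (gOfRecord₁₃ F N θ.toStage13Params p) p.K (k + 1) s V' ≠ 0 →
              slotsTOfRecord F N θ.ν θ.τ9 (EOfRecord₁₃ F N θ.toStage13Params) (wOfRecord₉ F N θ.toStage9Params) θ.ppSel p
                  (gOfRecord₁₃ F N θ.toStage13Params p) (k + 1) s V' =
                sect2Slot F N (FluctV N) p.K (settingOfRecord₁₃ F N θ.toStage13Params p) (θ.rzAt p s) (WtOfRecord₁₃H F N θ p s) s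
                  (t s.init) (Ek s.init) (UbgOfRecord₁₃CoP F N θ.toStage13Params p (k + 1) s) V') := by
  obtain ⟨t, Ek, hform, hloc, H⟩ :=
    exists_local_witness_clause_succ_of_hasSect2FormAtZS_of_borelB_of_bgRead θ p h (zhUnity_of_gaussCert θ hζ) hθ hpos hk hM hw cR Γr hreg hbg t₀ E₀ hform₀ hBt
  exact ⟨t, Ek, hform, hloc, fun s hΩ =>
    H s hΩ (prefix_agree_of_gaussCert θ p hζ hq s hΩ) (ζ0_pin_of_gaussCert θ p hζ hk s hΩ) (quad_empty_pairCfgAt_of_gaussCert θ p hq s)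
      (quad_local_of_gaussCert θ p hq s) (fun j Y => measurable_ζ0_of_gaussCert θ p hζ h s j Y) (fun j Λ' => measurable_quad_of_gaussCert θ p hq s j Λ')
      (afibre_rows_adm_of_coercive θ p s fun j => coercive_of_gaussCert θ p hq s j)⟩

/-- **★★★★ … ON THE SEPARATED-RANGE LINE OF RECORD** (`Provisos₁₃SepCoPH`: the record's row `bg` + partition compatibility + dag-n11-d's junction at SEPARATED indices `hJ` +
the print-void residue `hNS` at non-separated ones, p591971 `bgProvisoΛ_read_of_sep_of_junction_of_nonSep`): the Gaussian-class twin of dag-n11-d's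
`…SpaceTruncationAtSepIndices.exists_local_witness_clause_succ_of_hasSect2FormAtZS_of_borelB_of_sep_of_sepJunction` — for a named Borel §2 witness the no-expansion clause at
every history from `RegOn` + the junction + the window, the `BgProvisoΛ` row read off the record.
[cite: Balaban1988Convergent, Theorem p.245, Thm 1 p.262, (3.24)–(3.25) p.270, (2.10) p.256, (2.28) p.259; Balaban1985Variational, (7) p.278] -/
theorem exists_local_witness_clause_succ_of_gaussCert_of_borelB_of_sep_of_sepJunction
    (hζ : ∀ (p : B12.RunParams) (n : ℕ) (Ω Λ : ℕ → Set (Site (F.P p.K) 0)), (θ.Zh p n Ω Λ).ζ0 = (ZhPinOfRecord₁₃ θ.toStage13Params p Ω Λ).ζ0)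
    (hq : ∀ (p : B12.RunParams) (n : ℕ) (Ω Λ : ℕ → Set (Site (F.P p.K) 0)) (j : ℕ) (Λ' : Set (Site (F.P p.K) 0)) (ω : MultiCfg (F.P p.K) (SU N) (FluctV N)),
      (θ.Zh p n Ω Λ).quad j Λ' ω = ∑ b ∈ (Set.toFinite (bondsIn j (Λ'ᶜ ∩ Ω (j + 1)))).toFinset, ‖(ω j).2 b‖ ^ 2)
    (hsep : θ.Provisos₁₃SepCoPH F N) (hθ : θ.Admissible F N) (hpos : θ.s2.Pos) {k : ℕ} (hk : k < p.K) (hM : 1 ≤ θ.τ9.M) (hw : Step.InInterval θ.γ k (gOfRecord₁₃ F N θ.toStage13Params p))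
    (hPC : PartCompat₁₃ F N θ.toStage13Params p k) (cR : ℝ)
    (Γr : SeqOfRecord F θ.ν θ.τ9.M (gOfRecord₁₃ F N θ.toStage13Params p) p.K k → ℕ → Set (Site (F.P p.K) 0) → Set (Site (F.P p.K) 0))
    (hreg : ∀ s₀, (θ.zhAt p s₀).RegOn F N (FluctV N) θ.ν cR p (gOfRecord₁₃ F N θ.toStage13Params p) (Γr s₀))
    (hJ : ∀ s₀, Sect2.SeqSeparated θ.ν.M₁ s₀ → ∀ Wc : MSField (F.P p.K) (SU N),
      chiSeqOfRecord F N θ.ν θ.τ9.M (gOfRecord₁₃ F N θ.toStage13Params p) p.K k s₀ (Wc k) ≠ 0 →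
      (∀ j, j < k → PlaqSmallOn (plaqsOf (pts j (Γr s₀ j (s₀.Ω (j + 1))ᶜ))) (cR * epsOfRecord θ.ν (gOfRecord₁₃ F N θ.toStage13Params p) j) (Wc j)) →
      Wc ∈ suppOfRecord₁₃SepCoP F N θ.toStage13Params p k s₀)
    (hNS : ∀ s₀, ¬ Sect2.SeqSeparated θ.ν.M₁ s₀ → ∀ Wc : MSField (F.P p.K) (SU N),
      chiSeqOfRecord F N θ.ν θ.τ9.M (gOfRecord₁₃ F N θ.toStage13Params p) p.K k s₀ (Wc k) ≠ 0 →
      (∀ j, j < k → PlaqSmallOn (plaqsOf (pts j (Γr s₀ j (s₀.Ω (j + 1))ᶜ))) (cR * epsOfRecord θ.ν (gOfRecord₁₃ F N θ.toStage13Params p) j) (Wc j)) →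
      ∀ j, 1 ≤ j → j ≤ k → ∀ X : (Sect2.domSys (F.P p.K) θ.τ9.M j).Dom,
        (Sect2.domSites (F.P p.K) θ.τ9.M j X ⊆ s₀.Λ j →
          Sect2.ofBackgroundC (settingOfRecord₁₃ F N θ.toStage13Params p).ι (UbgOfRecord₁₃CoP F N θ.toStage13Params p k s₀ Wc) ∈
            Sect2.spaceI (settingOfRecord₁₃ F N θ.toStage13Params p) (θ.Rz p.K) θ.τ9.M j (Sect2.domSites (F.P p.K) θ.τ9.M j X)
              ((settingOfRecord₁₃ F N θ.toStage13Params p).lf.alpha0 ((settingOfRecord₁₃ F N θ.toStage13Params p).flow.g j))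
              ((settingOfRecord₁₃ F N θ.toStage13Params p).lf.alpha1 ((settingOfRecord₁₃ F N θ.toStage13Params p).flow.g j))) ∧
        (Sect2.admB (F.P p.K) θ.ν θ.τ9.M (gOfRecord₁₃ F N θ.toStage13Params p) s₀.Ω s₀.Λ j (Sect2.domSites (F.P p.K) θ.τ9.M j X) = true →
          Sect2.ofBackgroundC (settingOfRecord₁₃ F N θ.toStage13Params p).ι (UbgOfRecord₁₃CoP F N θ.toStage13Params p k s₀ Wc) ∈
            Sect2.spaceMS (settingOfRecord₁₃ F N θ.toStage13Params p) (θ.Rz p.K) θ.τ9.M j (Sect2.domSites (F.P p.K) θ.τ9.M j X) s₀.Ω))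
    (t₀ : SeqOfRecord F θ.ν θ.τ9.M (gOfRecord₁₃ F N θ.toStage13Params p) p.K k → Sect2.TermValues (F.P p.K) (MatA N) (FluctV N) θ.τ9.M)
    (E₀ : SeqOfRecord F θ.ν θ.τ9.M (gOfRecord₁₃ F N θ.toStage13Params p) p.K k → ℝ)
    (hform₀ : HasSect2FormAtZS F N (FluctV N) p.K (settingOfRecord₁₃ F N θ.toStage13Params p) k (θ.rzAt p) (WtOfRecord₁₃H F N θ p)
      (UbgOfRecord₁₃CoP F N θ.toStage13Params p k)
      (fun s₀ t' => Sect2.LawsRT (sect2TowerOfRecord F N (FluctV N) p.K (settingOfRecord₁₃ F N θ.toStage13Params p) (θ.rzAt p s₀) s₀ t')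
        (settingOfRecord₁₃ F N θ.toStage13Params p).lf k)
      (slotsOfRecord F N θ.ν θ.τ9 (EOfRecord₁₃ F N θ.toStage13Params) (wOfRecord₉ F N θ.toStage9Params) θ.ppSel p (gOfRecord₁₃ F N θ.toStage13Params p) k) t₀ E₀)
    (hBt : ∀ s₀ (S' : ℕ → Set (Site (F.P p.K) 0)) (j : ℕ) (X : (Sect2.domSys (F.P p.K) θ.τ9.M j).Dom),
      Measurable (fun q : GaugeField (F.P p.K) 0 (SU N) × MSFluct (F.P p.K) (FluctV N) =>
        (t₀ s₀).B j X (Sect2.ofBackgroundC (settingOfRecord₁₃ F N θ.toStage13Params p).ι q.1) (S', q.2))) :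
    ∃ (t : SeqOfRecord F θ.ν θ.τ9.M (gOfRecord₁₃ F N θ.toStage13Params p) p.K k → Sect2.TermValues (F.P p.K) (MatA N) (FluctV N) θ.τ9.M)
      (Ek : SeqOfRecord F θ.ν θ.τ9.M (gOfRecord₁₃ F N θ.toStage13Params p) p.K k → ℝ),
      HasSect2FormAtZS F N (FluctV N) p.K (settingOfRecord₁₃ F N θ.toStage13Params p) k (θ.rzAt p) (WtOfRecord₁₃H F N θ p)
          (UbgOfRecord₁₃CoP F N θ.toStage13Params p k)
          (fun s₀ t₀ => Sect2.LawsRT (sect2TowerOfRecord F N (FluctV N) p.K (settingOfRecord₁₃ F N θ.toStage13Params p) (θ.rzAt p s₀) s₀ t₀)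
            (settingOfRecord₁₃ F N θ.toStage13Params p).lf k)
          (slotsOfRecord F N θ.ν θ.τ9 (EOfRecord₁₃ F N θ.toStage13Params) (wOfRecord₉ F N θ.toStage9Params) θ.ppSel p
            (gOfRecord₁₃ F N θ.toStage13Params p) k) t Ek ∧
      (∀ s₀, IsFluctLocal k (t s₀)) ∧
      ∀ (s : SeqOfRecord F θ.ν θ.τ9.M (gOfRecord₁₃ F N θ.toStage13Params p) p.K (k + 1)), s.Ω (k + 1) = ∅ →
        (slotsTOfRecord F N θ.ν θ.τ9 (EOfRecord₁₃ F N θ.toStage13Params) (wOfRecord₉ F N θ.toStage9Params) θ.ppSel p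
            (gOfRecord₁₃ F N θ.toStage13Params p) (k + 1) s = 0 ∨
          ∀ᵐ V' ∂fieldMeasure (F.P p.K) (k + 1) (SU N),
            chiSeqOfRecord F N θ.ν θ.τ9.M (gOfRecord₁₃ F N θ.toStage13Params p) p.K (k + 1) s V' ≠ 0 →
              slotsTOfRecord F N θ.ν θ.τ9 (EOfRecord₁₃ F N θ.toStage13Params) (wOfRecord₉ F N θ.toStage9Params) θ.ppSel p
                  (gOfRecord₁₃ F N θ.toStage13Params p) (k + 1) s V' =
                sect2Slot F N (FluctV N) p.K (settingOfRecord₁₃ F N θ.toStage13Params p) (θ.rzAt p s) (WtOfRecord₁₃H F N θ p s) s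
                  (t s.init) (Ek s.init) (UbgOfRecord₁₃CoP F N θ.toStage13Params p (k + 1) s) V') :=
  exists_local_witness_clause_succ_of_gaussCert_of_borelB_of_bgRead θ p hζ hq hsep.toCore hθ hpos hk hM hw cR Γr hreg
    (BalabanUVNodesN11SpaceTruncationAtSepIndices.bgProvisoΛ_read_of_sep_of_junction_of_nonSep θ p cR Γr (hsep.bg p k hk.le hw hPC) hJ hNS) t₀ E₀ hform₀ hBt

end Summit.QuantumFields.YangMills.Theorems.BalabanUVNodesN11GaussianCertificateBgRead

end
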